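import Mathlib.Analysis.SpecialFunctions.Complex.Log
import Mathlib.Analysis.Asymptotics.Lemmas
import Mathlib.NumberTheory.Real.Irrational
import Literature.NumberTheory.UniformDistribution.EquidistributedModOne
import Literature.NumberTheory.UniformDistribution.EquidistributedModOnePi
import HarnessLib

/-!
# Uniform distribution modulo one: invariances, obstructions, `(nθ)` for rational `θ`

Topic `Literature/NumberTheory/UniformDistribution`; proof sibling (theorems only — no definition, no
named fact) of `EquidistributedModOne.lean` (Kuipers–Niederreiter 1974, Ch. 1, Def. 1.1 and
Thm. 2.1: `EquidistributedModOne`, `equidistributedModOne_iff_isLittleO_weylSum`),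
`EquidistributedModOnePi.lean` (Def. 6.1, Thm. 6.2: `EquidistributedModOnePi`,
`equidistributedModOnePi_iff_isLittleO_weylSumPi`). It adds the elementary closure properties of
u.d. mod 1 printed in Kuipers–Niederreiter, Ch. 1, §§1–2, §6 and Murty 2008, §11.1, all proved:

* `equidistributedModOne_congr_int`, `equidistributedModOne_fract_iff` — u.d. mod 1 depends only
  on the terms modulo `ℤ` (Def. 1.1 is stated through `{x_n}`; Murty, §11.1: *"it is convenient to
  take a sequence satisfying `0 ≤ x_n < 1`"*);
* `equidistributedModOne_add_const_iff` (Kuipers–Niederreiter Lemma 1.1 / Murty Exercise 11.1.13,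
  as an equivalence) and `equidistributedModOne_comp_add_iff` (the tree's one-directional
  `EquidistributedModOne.add_const`, `….comp_add` upgraded to `↔`);
* obstructions (necessity in Weyl's criterion, Thm. 2.1): `not_equidistributedModOne_of_int_mul_sub_mem`
  (a non-zero integer multiple constant mod 1), `not_equidistributedModOne_const`,
  `not_equidistributedModOne_nat_mul_of_rat` (Murty, Exercise 11.1.9: *"If `θ` is rational, show
  that the sequence `x_n = nθ` is not u.d."*), hence with the tree's `equidistributedModOne_nat_mul`
  (Example 2.1) the equivalence `equidistributedModOne_nat_mul_iff : u.d. of (nθ) ↔ Irrational θ`;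
* on the torus (for `EquidistributedModOnePi`): each coordinate of a u.d. sequence is u.d.
  (`EquidistributedModOnePi.coord`: the Weyl sum of the `j`-th coordinate at `k` is the Weyl sum of
  `x` at the lattice point `k e_j`; Kuipers–Niederreiter Thm. 6.3 with a unit vector) and constant
  vector shifts (`EquidistributedModOnePi.add_const`; with the tree's Kronecker–Weyl theorem
  `equidistributedModOnePi_nat_mul_fin` of `KroneckerSequence.lean` this gives the shifted Kronecker
  sequences `(nθ_j + c_j)_j`, Kuipers–Niederreiter Example 6.1).

## References

* L. Kuipers, H. Niederreiter, *Uniform distribution of sequences*, Wiley 1974: Ch. 1, §1 (Def. 1.1,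
  Lemma 1.1), §2 (Thm. 2.1, Example 2.1), §6 (Thms. 6.2–6.3, Example 6.1). [KuipersNiederreiter1974]
* M. R. Murty, *Problems in analytic number theory*, 2nd ed., GTM 206, Springer 2008, §11.1:
  Thm. 11.1.5, Exercises 11.1.9, 11.1.13 (read in the held copy). [Murty2008]
* H. Weyl, *Über die Gleichverteilung von Zahlen mod. Eins*, Math. Ann. 77 (1916) 313–352, §§1–2.
  [Weyl1916]
-/

noncomputable section

open Filter Asymptotics Finset
open scoped Topology Real

namespace Literature.NumberTheory.UniformDistribution

/-! ### Bookkeeping: the phase `exp(2πix)` and `o(N)` -/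

/-- `exp(2πi(x + k)) = exp(2πix)` for `k ∈ ℤ`. [folklore] -/
theorem cexp_two_pi_mul_ofReal_add_intCast (x : ℝ) (k : ℤ) :
    Complex.exp (2 * Real.pi * Complex.I * ((x + k : ℝ) : ℂ)) =
      Complex.exp (2 * Real.pi * Complex.I * (x : ℂ)) := by
  have hk : Complex.exp (2 * Real.pi * Complex.I * (k : ℂ)) = 1 := by
    rw [show 2 * Real.pi * Complex.I * (k : ℂ) = (k : ℂ) * (2 * Real.pi * Complex.I) by ring]
    exact Complex.exp_int_mul_two_pi_mul_I k
  push_cast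
  rw [mul_add, Complex.exp_add, hk, mul_one]

/-- `‖exp(2πix)‖ = 1` for real `x`. [folklore] -/
theorem norm_cexp_two_pi_mul_ofReal (x : ℝ) :
    ‖Complex.exp (2 * Real.pi * Complex.I * (x : ℂ))‖ = 1 := by
  rw [show (2 * Real.pi * Complex.I * (x : ℂ)) = ((2 * Real.pi * x : ℝ) : ℂ) * Complex.I by
    push_cast; ring]
  exact Complex.norm_exp_ofReal_mul_I _

/-- A bounded sequence is `o(N)`. [folklore] -/
theorem isLittleO_natCast_of_norm_le {E : Type*} [NormedAddCommGroup E] {f : ℕ → E} {C : ℝ}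
    (hf : ∀ N, ‖f N‖ ≤ C) : f =o[atTop] fun N : ℕ => (N : ℝ) := by
  have h1 : f =O[atTop] fun _ : ℕ => (1 : ℝ) :=
    IsBigO.of_bound C (Eventually.of_forall fun N => by simpa using hf N)
  have h2 : (fun _ : ℕ => (1 : ℝ)) =o[atTop] fun N : ℕ => (N : ℝ) := by
    refine isLittleO_const_left.mpr (Or.inr ?_)
    simpa only [Function.comp_def, Real.norm_natCast] using tendsto_natCast_atTop_atTop
  exact h1.trans_isLittleO h2

/-- `N` is not `o(N)`: a sequence with `‖f N‖ = N` is not `o(N)`. [folklore] -/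
theorem not_isLittleO_natCast_of_norm_eq {E : Type*} [NormedAddCommGroup E] {f : ℕ → E}
    (hf : ∀ N, ‖f N‖ = N) : ¬ f =o[atTop] fun N : ℕ => (N : ℝ) := by
  intro h
  have hev := h.def one_half_pos
  obtain ⟨N, hN, hN1⟩ := (hev.and (eventually_ge_atTop 1)).exists
  rw [hf N, Real.norm_natCast] at hN
  have : (1 : ℝ) ≤ N := by exact_mod_cast hN1
  linarith

/-! ### Terms modulo `ℤ`, constant shifts, index shifts -/

/-- **Changing terms by integers**: if `v_n ≡ u_n (mod 1)` for all `n`, then `u` is u.d. mod 1 iff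
`v` is — the counting functions agree, `{v_n} = {u_n}`. Kuipers–Niederreiter 1974, Ch. 1, Def. 1.1
(stated through the fractional parts); Murty 2008, §11.1. [cite: KuipersNiederreiter1974, Ch. 1 Def. 1.1] -/
theorem equidistributedModOne_congr_int {u v : ℕ → ℝ} (huv : ∀ n, ∃ k : ℤ, v n = u n + k) :
    EquidistributedModOne u ↔ EquidistributedModOne v := by
  have key : ∀ a b N, fractCount v a b N = fractCount u a b N := by
    intro a b N
    unfold fractCount
    congr 1
    refine Finset.filter_congr fun n _ => ?_
    obtain ⟨k, hk⟩ := huv n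
    rw [hk, Int.fract_add_intCast]
  simp only [equidistributedModOne_iff, key]

/-- u.d. mod 1 only depends on the fractional parts: `({u_n})` is u.d. iff `(u_n)` is.
Kuipers–Niederreiter 1974, Ch. 1, Def. 1.1; Murty 2008, §11.1.
[cite: KuipersNiederreiter1974, Ch. 1 Def. 1.1] -/
theorem equidistributedModOne_fract_iff (u : ℕ → ℝ) :
    EquidistributedModOne (fun n => Int.fract (u n)) ↔ EquidistributedModOne u :=
  (equidistributedModOne_congr_int (u := u) (v := fun n => Int.fract (u n))
    fun n => ⟨-⌊u n⌋, by rw [Int.fract, Int.cast_neg, sub_eq_add_neg]⟩).symm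

/-- **Shift by a constant, as an equivalence**: `(u_n + c)` is u.d. mod 1 iff `(u_n)` is
(`EquidistributedModOne.add_const` applied to `c` and to `−c`). Kuipers–Niederreiter 1974, Ch. 1,
Lemma 1.1; Murty 2008, Exercise 11.1.13. [cite: KuipersNiederreiter1974, Ch. 1 Lemma 1.1] -/
theorem equidistributedModOne_add_const_iff (u : ℕ → ℝ) (c : ℝ) :
    EquidistributedModOne (fun n => u n + c) ↔ EquidistributedModOne u := by
  refine ⟨fun H => ?_, fun H => H.add_const c⟩
  have := H.add_const (-c)
  simpa using this

/-- The Weyl sums of the index-shifted sequence `n ↦ u_{n+k}`: `S_{u(·+k)}(N) = S_u(k+N) − S_u(k)`.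
[folklore] -/
theorem weylSum_comp_add (u : ℕ → ℝ) (k : ℕ) (h : ℤ) (N : ℕ) :
    weylSum (fun n => u (n + k)) h N = weylSum u h (k + N) - weylSum u h k := by
  unfold weylSum
  rw [Finset.sum_range_add, add_sub_cancel_left]
  refine Finset.sum_congr rfl fun n _ => ?_
  dsimp only
  rw [add_comm n k]

/-- **Shift of the index, as an equivalence**: `(u_{n+k})_n` is u.d. mod 1 iff `(u_n)_n` is
(`EquidistributedModOne.comp_add` gives "⇐"; for "⇒", `S_u(N) = S_{u(·+k)}(N − k) + S_u(k)` for
`N ≥ k` in Weyl's criterion). [folklore] -/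
theorem equidistributedModOne_comp_add_iff (u : ℕ → ℝ) (k : ℕ) :
    EquidistributedModOne (fun n => u (n + k)) ↔ EquidistributedModOne u := by
  refine ⟨fun H => ?_, fun H => H.comp_add k⟩
  rw [equidistributedModOne_iff_isLittleO_weylSum] at H ⊢
  intro h hh
  have Hk := H h hh
  have hfun : weylSum (fun n => u (n + k)) h = fun N => weylSum u h (k + N) - weylSum u h k :=
    funext (weylSum_comp_add u k h)
  rw [hfun] at Hk
  have hconst : (fun _ : ℕ => weylSum u h k) =o[atTop] fun N : ℕ => (N : ℝ) :=
    isLittleO_natCast_of_norm_le (C := ‖weylSum u h k‖) fun _ => le_rfl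
  have hsub : (fun N : ℕ => ((N - k : ℕ) : ℝ)) =O[atTop] fun N : ℕ => (N : ℝ) := by
    refine IsBigO.of_bound 1 (Eventually.of_forall fun N => ?_)
    rw [Real.norm_natCast, Real.norm_natCast, one_mul]
    exact_mod_cast Nat.sub_le N k
  have H1 : (fun N : ℕ => weylSum u h (k + (N - k)) - weylSum u h k) =o[atTop]
      fun N : ℕ => ((N - k : ℕ) : ℝ) :=
    Hk.comp_tendsto (tendsto_sub_atTop_nat k)
  have H2 := (H1.trans_isBigO hsub).add hconst
  refine H2.congr' ?_ EventuallyEq.rfl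
  filter_upwards [eventually_ge_atTop k] with N hN
  simp only [Nat.add_sub_cancel' hN, sub_add_cancel]

/-! ### Obstructions: a frequency at which the Weyl sum has norm `N` -/

/-- If for some integer `h ≠ 0` all the `h u_n` are congruent mod `1` to one real number `c`, then
`u` is not u.d. mod 1: the Weyl sum at `h` is `N e(c)`, of norm `N ≠ o(N)` (necessity in Weyl's
criterion, Kuipers–Niederreiter 1974, Ch. 1, Thm. 2.1; Murty 2008, Thm. 11.1.5).
[cite: KuipersNiederreiter1974, Ch. 1 Thm. 2.1] -/
theorem not_equidistributedModOne_of_int_mul_sub_mem {u : ℕ → ℝ} {h : ℤ} (hh : h ≠ 0) (c : ℝ)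
    (hc : ∀ n, ∃ k : ℤ, (h : ℝ) * u n = c + k) : ¬ EquidistributedModOne u := by
  intro hu
  have key : ∀ N, ‖weylSum u h N‖ = N := by
    intro N
    have : weylSum u h N = N * Complex.exp (2 * Real.pi * Complex.I * (c : ℂ)) := by
      unfold weylSum
      rw [Finset.sum_congr rfl fun n _ => ?_, Finset.sum_const, Finset.card_range, nsmul_eq_mul]
      obtain ⟨k, hk⟩ := hc n
      rw [hk, cexp_two_pi_mul_ofReal_add_intCast]
    rw [this, norm_mul, norm_cexp_two_pi_mul_ofReal, mul_one, Complex.norm_natCast]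
  exact not_isLittleO_natCast_of_norm_eq key
    ((equidistributedModOne_iff_isLittleO_weylSum u).mp hu h hh)

/-- A constant sequence is not u.d. mod 1 (a u.d. sequence is dense mod 1: Murty 2008, §11.1,
remark after the definition; Kuipers–Niederreiter 1974, Ch. 1, §1). [cite: Murty2008, §11.1] -/
theorem not_equidistributedModOne_const (c : ℝ) : ¬ EquidistributedModOne fun _ : ℕ => c :=
  not_equidistributedModOne_of_int_mul_sub_mem one_ne_zero c fun _ => ⟨0, by simp⟩

/-- For rational `θ = q` the sequence `(n θ)` is not u.d. mod 1 (at the frequency `h = den q` the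
terms `h n θ = n · num q` are integers). Murty 2008, Exercise 11.1.9: *"If `θ` is rational, show
that the sequence `x_n = nθ` is not u.d."* [cite: Murty2008, Exercise 11.1.9] -/
theorem not_equidistributedModOne_nat_mul_of_rat (q : ℚ) :
    ¬ EquidistributedModOne fun n : ℕ => n * (q : ℝ) := by
  refine not_equidistributedModOne_of_int_mul_sub_mem (h := q.den)
    (by exact_mod_cast q.den_ne_zero) 0 fun n => ⟨n * q.num, ?_⟩
  have hq : ((q.den : ℤ) : ℝ) * (q : ℝ) = q.num := by
    have h' : ((q.den : ℚ) * q : ℚ) = (q.num : ℚ) := Rat.den_mul_eq_num q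
    have h'' : (((q.den : ℚ) * q : ℚ) : ℝ) = ((q.num : ℚ) : ℝ) := by rw [h']
    push_cast at h'' ⊢
    exact h''
  calc ((q.den : ℤ) : ℝ) * (n * (q : ℝ)) = n * (((q.den : ℤ) : ℝ) * (q : ℝ)) := by ring
    _ = 0 + ((n * q.num : ℤ) : ℝ) := by rw [hq]; push_cast; ring

/-- **`(n θ)` is u.d. mod 1 iff `θ` is irrational** (the tree's `equidistributedModOne_nat_mul`,
Kuipers–Niederreiter Example 2.1 / Murty Exercise 11.1.8, and
`not_equidistributedModOne_nat_mul_of_rat`, Murty Exercise 11.1.9).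
[cite: Murty2008, Exercises 11.1.8–11.1.9] [cite: KuipersNiederreiter1974, Ch. 1 Example 2.1] -/
theorem equidistributedModOne_nat_mul_iff (θ : ℝ) :
    EquidistributedModOne (fun n : ℕ => n * θ) ↔ Irrational θ := by
  refine ⟨fun hu => ?_, equidistributedModOne_nat_mul⟩
  by_contra hθ
  obtain ⟨q, rfl⟩ : θ ∈ Set.range ((↑) : ℚ → ℝ) := by
    simpa [Irrational] using hθ
  exact not_equidistributedModOne_nat_mul_of_rat q hu

/-! ### The torus: coordinates, constant shifts, shifted Kronecker sequences -/

section Torus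

variable {ι : Type*} [Fintype ι]

/-- The Weyl sum of the `j`-th coordinate sequence at the frequency `k` is the Weyl sum of `x` at
the lattice point `k e_j`. [cite: KuipersNiederreiter1974, Ch. 1 Thm. 6.3] -/
theorem weylSum_coord [DecidableEq ι] (x : ℕ → ι → ℝ) (j : ι) (k : ℤ) :
    weylSum (fun n => x n j) k = weylSumPi x (Pi.single j k) := by
  funext N
  unfold weylSum weylSumPi
  refine Finset.sum_congr rfl fun n _ => ?_
  congr 3
  rw [Finset.sum_eq_single j (fun i _ hij => by rw [Pi.single_eq_of_ne hij, Int.cast_zero, zero_mul])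
    (fun hj => absurd (Finset.mem_univ j) hj), Pi.single_eq_same]

/-- **Coordinates**: each coordinate of a sequence u.d. mod 1 in `ℝ^ι` is u.d. mod 1 — the two
Weyl criteria of the tree (`equidistributedModOnePi_iff_isLittleO_weylSumPi`, Thm. 6.2, and
`equidistributedModOne_iff_isLittleO_weylSum`, Thm. 2.1) with `weylSum_coord`; this is
Kuipers–Niederreiter 1974, Ch. 1, Thm. 6.3 for the unit vectors `h = e_j`.
[cite: KuipersNiederreiter1974, Ch. 1 Thm. 6.3] -/
theorem EquidistributedModOnePi.coord [DecidableEq ι] {x : ℕ → ι → ℝ}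
    (hx : EquidistributedModOnePi x) (j : ι) : EquidistributedModOne fun n => x n j := by
  rw [equidistributedModOne_iff_isLittleO_weylSum]
  rw [equidistributedModOnePi_iff_isLittleO_weylSumPi] at hx
  intro k hk
  rw [weylSum_coord]
  refine hx _ fun H => hk ?_
  have := congrFun H j
  rwa [Pi.single_eq_same, Pi.zero_apply] at this

/-- **Shift by a constant vector** on the torus: if `x` is u.d. mod 1 in `ℝ^ι`, so is
`(x_n + c)_n` (the Weyl sum at `h` is multiplied by the unit `e(⟨h, c⟩)`; Kuipers–Niederreiter
1974, Ch. 1, §6 with Lemma 1.1). [cite: KuipersNiederreiter1974, Ch. 1 §6] -/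
theorem EquidistributedModOnePi.add_const {x : ℕ → ι → ℝ} (hx : EquidistributedModOnePi x)
    (c : ι → ℝ) : EquidistributedModOnePi fun n i => x n i + c i := by
  rw [equidistributedModOnePi_iff_isLittleO_weylSumPi] at hx ⊢
  intro h hh
  have key : weylSumPi (fun n i => x n i + c i) h = fun N =>
      Complex.exp (2 * Real.pi * Complex.I * ((∑ i, (h i : ℝ) * c i : ℝ) : ℂ)) *
        weylSumPi x h N := by
    funext N
    unfold weylSumPi
    rw [Finset.mul_sum]
    refine Finset.sum_congr rfl fun n _ => ?_
    rw [← Complex.exp_add]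
    congr 1
    have : ∑ i, (h i : ℝ) * (x n i + c i) = ∑ i, (h i : ℝ) * c i + ∑ i, (h i : ℝ) * x n i := by
      rw [← Finset.sum_add_distrib]
      refine Finset.sum_congr rfl fun i _ => ?_
      ring
    rw [this]
    push_cast
    ring
  rw [key]
  exact (hx h hh).const_mul_left _

end Torus

end Literature.NumberTheory.UniformDistribution

end
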